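import Summits.CriticalPhenomena.PercolationContinuityZ3.Theorems.Transplant.KNParaChainLocDN
import Summits.CriticalPhenomena.PercolationContinuityZ3.Theorems.Transplant.SkelPhiParaBandChainS
import HarnessLib

/-!
# N1 (the `{±1}` node), LEVEL 1, (C) column under S1 (small arrival box; C-STEP0.md §4–§5): SIGNED v-ROUNDS IN THE RUN FRAME OF SIGN `1` —
# the drift-localisation record `Skelφ.vLocPrmD n ℓ h v e W L0 N : ChainPara.LocPrmD` (along axis `1 = ⌊β′/U⌋`: floored readings `sLo = ⌊(nℓ−U+1)/U⌋ − 1`,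
# `sHi = ⌊nℓ/U⌋ + 1` as `yPrmX`; transverse axis `0 = α` EXACT with the walker-signed drift `d = v`: pieces `σΔα − v ∈ [0, n − v]` / `[−(n + v), 0]`;
# link box `La = ⌊3nℓ/U⌋ + 1`, `Lb = n`), its admissibility, and the two route readings of a centre-bound v-stride: the LINK REGION of a seed centre
# in the enlarged core is read into the region, and the steered TOP PIECE (`σ_w := dir (level offset)`, `τ := steerT σ_w (α offset)`) into the next core.
# Over SMALL cores only (a few rounds: transverse growth `e + |v|` per round) — the re-tightening segment A of the one-frame corridor.

builds on p205010 (kernel theorem, internal audit signed; external expert review pending) — nothing in this file uses p205010; nothing here is a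
claim about the open node `SamePDropOfSkeletonNeg`.
Lane `prim-bschramm`, seat `prim-bschramm-p5` (gen 9; (C) lineage); helper file (`--supports stmt-CriticalPhenomena-4575`).
* §1 **`vLocPrmD`**, `vLocPrmD_ok` (`1 ≤ n`, `|v| ≤ n`, `n ≤ W`, two layers `2U ≤ nℓ + 1`, `e·U + 2U ≤ nℓ + 1` i.e. `e ≤ sLo`), `vLocPrmD_d/_Lb`, `mem_vLocDSched_enl_iff`;
* §2 **`runX_mem_vlocDRegion_of_link`**, **`runX_mem_vlocDCore_succ_of_piece`** — the (h3) readings the kit clause of segment A consumes.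
[cite: KozmaNitzan2024, §4 Lemma 12 (pp. 23–25), Lemma 11 (p. 22)] [cite: MartineauTassion2017, §3.2 Lemma 3.5 (L(v,b), L(−a,v)), §4.3 Lemma 4.2]
-/

noncomputable section

namespace Summit.CriticalPhenomena.PercolationContinuityZ3.Theorems.Transplant

namespace Skelφ

open Literature.Probability.Percolation Literature.Probability.LatticeModels SimpleGraph
open Literature.Probability.Percolation.KozmaNitzan.Cells (oth)
open ChainPlanar ChainPara

variable {V : Type} {G : SimpleGraph V} {φ : V → Site 2}

/-- `oth 1 = 0` on `Fin 2`. [folklore] -/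
private theorem oth_one₁ : oth (1 : Fin 2) = 0 := by decide

/-! ## §1 The v-round record in window units -/

/-- **Signed v-rounds in the run frame of sign `1`** (drift-localisation along axis `1 = ⌊β′/U⌋`, transverse `α` exact with drift `v`): stride readings
`[⌊(nℓ−U+1)/U⌋ − 1, ⌊nℓ/U⌋ + 1]`, pieces `n ∓ v` about the drift, window `W`, siting slack `e`, link box `(⌊3nℓ/U⌋ + 1) × n`, start half-width `L0`, rounds `N`.
[this work] -/
def vLocPrmD (n ℓ : ℕ) (h v : ℤ) (e W L0 N : ℕ) : LocPrmD where
  sLo := ((n : ℤ) * ℓ - (shearUnit n h : ℕ) + 1) / (shearUnit n h : ℕ) - 1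
  sHi := (n : ℤ) * ℓ / (shearUnit n h : ℕ) + 1
  d := v
  Pp := (n - v).toNat
  Pm := (n + v).toNat
  W := W
  e := e
  La := 3 * (n * ℓ) / shearUnit n h + 1
  Lb := n
  L0 := L0
  N := N

/-- The v-round record's drift is `v`. [folklore] -/
@[simp] theorem vLocPrmD_d (n ℓ : ℕ) (h v : ℤ) (e W L0 N : ℕ) : (vLocPrmD n ℓ h v e W L0 N).d = v := rfl

/-- The v-round record's transverse link half-size is `n`. [folklore] -/
@[simp] theorem vLocPrmD_Lb (n ℓ : ℕ) (h v : ℤ) (e W L0 N : ℕ) : (vLocPrmD n ℓ h v e W L0 N).Lb = n := rfl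

/-- The v-round record's fields `W, e, L0, N`. [folklore] -/
theorem vLocPrmD_fields (n ℓ : ℕ) (h v : ℤ) (e W L0 N : ℕ) :
    (vLocPrmD n ℓ h v e W L0 N).W = W ∧ (vLocPrmD n ℓ h v e W L0 N).e = e ∧ (vLocPrmD n ℓ h v e W L0 N).L0 = L0 ∧ (vLocPrmD n ℓ h v e W L0 N).N = N :=
  ⟨rfl, rfl, rfl, rfl⟩

/-- **Admissibility of the v-rounds**: `1 ≤ n`, `|v| ≤ n`, both drifted pieces inside the window (`n ≤ W`), and the siting slack below the minimal floored
progress (`(e + 2)·U ≤ nℓ + 1`, `U = n + |h|`). [folklore] -/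
theorem vLocPrmD_ok {n ℓ : ℕ} {h v : ℤ} {e W : ℕ} (hn : 1 ≤ n) (hv : |v| ≤ n) (hW : n ≤ W)
    (he : ((e : ℤ) + 2) * ((n + h.natAbs : ℕ) : ℤ) ≤ (n : ℤ) * ℓ + 1) (L0 N : ℕ) : LocOKD (vLocPrmD n ℓ h v e W L0 N) where
  hs0 := by
    simp only [vLocPrmD]
    have hc : (0 : ℤ) < (shearUnit n h : ℕ) := shearUnit_pos hn h
    have hU : ((shearUnit n h : ℕ) : ℤ) = ((n + h.natAbs : ℕ) : ℤ) := rfl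
    have he' : 2 * ((shearUnit n h : ℕ) : ℤ) ≤ (n : ℤ) * ℓ + 1 := by
      rw [hU]; have h0 : (0 : ℤ) ≤ (e : ℤ) * ((n + h.natAbs : ℕ) : ℤ) := by positivity
      nlinarith
    have h1 : (1 : ℤ) ≤ ((n : ℤ) * ℓ - (shearUnit n h : ℕ) + 1) / (shearUnit n h : ℕ) := by
      rw [Int.le_ediv_iff_mul_le hc]; linarith
    linarith
  hs := by
    simp only [vLocPrmD]
    have hc : (0 : ℤ) < (shearUnit n h : ℕ) := shearUnit_pos hn h
    have h1 : ((n : ℤ) * ℓ - (shearUnit n h : ℕ) + 1) / (shearUnit n h : ℕ) ≤ (n : ℤ) * ℓ / (shearUnit n h : ℕ) :=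
      Int.ediv_le_ediv hc (by linarith)
    linarith
  hsL := by
    simp only [vLocPrmD]
    push_cast
    have hc : (0 : ℤ) < (shearUnit n h : ℕ) := shearUnit_pos hn h
    have h1 : (n : ℤ) * ℓ / (shearUnit n h : ℕ) ≤ 3 * ((n : ℤ) * ℓ) / (shearUnit n h : ℕ) :=
      Int.ediv_le_ediv hc (by linarith [show (0 : ℤ) ≤ (n : ℤ) * ℓ by positivity])
    linarith
  hPp := by
    simp only [vLocPrmD]
    rw [Int.toNat_of_nonneg (by linarith [(abs_le.1 hv).2])]
    have : (n : ℤ) ≤ W := by exact_mod_cast hW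
    linarith
  hPm := by
    simp only [vLocPrmD]
    rw [Int.toNat_of_nonneg (by linarith [(abs_le.1 hv).1])]
    have : (n : ℤ) ≤ W := by exact_mod_cast hW
    linarith
  he := by
    simp only [vLocPrmD]
    have hc : (0 : ℤ) < (shearUnit n h : ℕ) := shearUnit_pos hn h
    have hU : ((shearUnit n h : ℕ) : ℤ) = ((n + h.natAbs : ℕ) : ℤ) := rfl
    have he' : ((e : ℤ) + 2) * ((shearUnit n h : ℕ) : ℤ) ≤ (n : ℤ) * ℓ + 1 := by rw [hU]; exact he
    have h1 : (e : ℤ) + 1 ≤ ((n : ℤ) * ℓ - (shearUnit n h : ℕ) + 1) / (shearUnit n h : ℕ) := by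
      rw [Int.le_ediv_iff_mul_le hc]; nlinarith
    linarith

/-- The drift fits the transverse link half-size: `|v| ≤ Lb = n`. [folklore] -/
theorem vLocPrmD_dL {n ℓ : ℕ} {h v : ℤ} (hv : |v| ≤ n) (e W L0 N : ℕ) : |(vLocPrmD n ℓ h v e W L0 N).d| ≤ (vLocPrmD n ℓ h v e W L0 N).Lb := by
  simpa [vLocPrmD] using hv

/-- Membership in the `R′`-enlarged core `k` of the v-round schedule (axis `1`, centre `0`) = offsets `(y 1, y 0)` in the enlarged core. [folklore] -/
theorem mem_vLocDSched_enl_iff {P : LocPrmD} (hP : LocOKD P) (hdL : |P.d| ≤ P.Lb) {k : ℕ} {y : Site 2} :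
    y ∈ Finset.Icc ((P.scheduleN 1 0 hP hdL).lo k - (((P.scheduleN 1 0 hP hdL).R' : ℕ) : Site 2))
        ((P.scheduleN 1 0 hP hdL).hi k + (((P.scheduleN 1 0 hP hdL).R' : ℕ) : Site 2)) ↔ P.InEnl k (y 1) (y 0) := by
  show y ∈ Finset.Icc (dLo 1 1 0 (-P.toLoc.L k) (P.toLoc.L k) (-P.Wk k) (P.Wk k) - ((P.e : ℕ) : Site 2))
      (dHi 1 1 0 (-P.toLoc.L k) (P.toLoc.L k) (-P.Wk k) (P.Wk k) + ((P.e : ℕ) : Site 2)) ↔ _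
  rw [dBox_enlarge (Or.inl rfl), LocPrmD.mem_enlarge_iff]
  simp [oth_one₁, LocPrmD.InEnl, LocPrmD.Wk]

/-! ## §2 The route readings of a centre-bound v-stride -/

section VRounds

variable {n ℓ : ℕ} {h v : ℤ} {e W : ℕ} (hn : 1 ≤ n) (hv : |v| ≤ n) (hW : n ≤ W)
  (he : ((e : ℤ) + 2) * ((n + h.natAbs : ℕ) : ℤ) ≤ (n : ℤ) * ℓ + 1) (L0 N : ℕ) (c₀ : V)
include hn

/-- **Link ⊆ region, signed v-rounds**: `runX t` in the `R′`-enlarged core `k` of `(vLocPrmD …).scheduleN 1 0` and `w ∈ pgramPrism t n h (3ℓ) R` give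
`runX w ∈ region k` (the x-record's link numbers `La = n`, `Lb = ⌊3nℓ/U⌋ + 1` are the v-record's `Lb`, `La`). [cite: KozmaNitzan2024, §4 Lemma 11 (p. 22)] -/
theorem runX_mem_vlocDRegion_of_link {k : ℕ} {t w : V} {R : ℕ}
    (ht : runX φ c₀ n h 1 t ∈ Finset.Icc
      (((vLocPrmD n ℓ h v e W L0 N).scheduleN 1 0 (vLocPrmD_ok hn hv hW he L0 N) (vLocPrmD_dL hv e W L0 N)).lo k -
        ((((vLocPrmD n ℓ h v e W L0 N).scheduleN 1 0 (vLocPrmD_ok hn hv hW he L0 N) (vLocPrmD_dL hv e W L0 N)).R' : ℕ) : Site 2))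
      (((vLocPrmD n ℓ h v e W L0 N).scheduleN 1 0 (vLocPrmD_ok hn hv hW he L0 N) (vLocPrmD_dL hv e W L0 N)).hi k +
        ((((vLocPrmD n ℓ h v e W L0 N).scheduleN 1 0 (vLocPrmD_ok hn hv hW he L0 N) (vLocPrmD_dL hv e W L0 N)).R' : ℕ) : Site 2)))
    (hw : w ∈ pgramPrism G φ t n h (3 * ℓ) R) :
    runX φ c₀ n h 1 w ∈ ((vLocPrmD n ℓ h v e W L0 N).scheduleN 1 0 (vLocPrmD_ok hn hv hW he L0 N) (vLocPrmD_dL hv e W L0 N)).region k := by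
  have ht' := (mem_vLocDSched_enl_iff (vLocPrmD_ok hn hv hW he L0 N) (vLocPrmD_dL hv e W L0 N)).1 ht
  obtain ⟨h0, h1⟩ := link_runX hn c₀ h (Or.inl rfl) hw e 0 N
  rw [LocPrmD.scheduleN_region, LocPrmD.mem_pregion_iff]
  simp only [Pi.zero_apply, sub_zero, oth_one₁]
  obtain ⟨ha, hb⟩ := ht'
  have hLa : ((vLocPrmD n ℓ h v e W L0 N).La : ℤ) = ((xPrmW n ℓ h e 0 N).Lb : ℤ) := by simp [vLocPrmD, xPrmW]
  have hLb : ((vLocPrmD n ℓ h v e W L0 N).Lb : ℤ) = ((xPrmW n ℓ h e 0 N).La : ℤ) := by simp [vLocPrmD, xPrmW]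
  constructor
  · calc |runX φ c₀ n h 1 w 1| = |(runX φ c₀ n h 1 w 1 - runX φ c₀ n h 1 t 1) + runX φ c₀ n h 1 t 1| := by ring_nf
      _ ≤ |runX φ c₀ n h 1 w 1 - runX φ c₀ n h 1 t 1| + |runX φ c₀ n h 1 t 1| := abs_add_le _ _
      _ ≤ ((xPrmW n ℓ h e 0 N).Lb : ℤ) + ((vLocPrmD n ℓ h v e W L0 N).toLoc.L k + (vLocPrmD n ℓ h v e W L0 N).e) := add_le_add h1 ha
      _ = _ := by rw [← hLa]; ring
  · calc |runX φ c₀ n h 1 w 0| = |(runX φ c₀ n h 1 w 0 - runX φ c₀ n h 1 t 0) + runX φ c₀ n h 1 t 0| := by ring_nf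
      _ ≤ |runX φ c₀ n h 1 w 0 - runX φ c₀ n h 1 t 0| + |runX φ c₀ n h 1 t 0| := abs_add_le _ _
      _ ≤ ((xPrmW n ℓ h e 0 N).La : ℤ) + ((vLocPrmD n ℓ h v e W L0 N).Wk k + (vLocPrmD n ℓ h v e W L0 N).e) := add_le_add h0 hb
      _ = _ := by rw [← hLb, LocPrmD.Wk]; simp only [vLocPrmD]; ring

/-- **THE STEERED TOP PIECE OF THE CENTRE-BOUND v-STRIDE IS READ INTO THE NEXT CORE** (signed v-rounds): with `σ_w := dir (runX t 1)` (towards the centre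
level) and `τ₀ := steerT σ_w (runX t 0)` (towards the centre line in `α`), every `w ∈ pgTopPieceW t n h ℓ R σ_w τ₀ v` has `runX w ∈ core (k+1)`.
[cite: KozmaNitzan2024, §4 Lemma 12 (pp. 23–25)] [cite: MartineauTassion2017, §4.3 Lemma 4.2] -/
theorem runX_mem_vlocDCore_succ_of_piece [G.LocallyFinite] {k : ℕ} {t w : V} {R : ℕ}
    (ht : runX φ c₀ n h 1 t ∈ Finset.Icc
      (((vLocPrmD n ℓ h v e W L0 N).scheduleN 1 0 (vLocPrmD_ok hn hv hW he L0 N) (vLocPrmD_dL hv e W L0 N)).lo k -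
        ((((vLocPrmD n ℓ h v e W L0 N).scheduleN 1 0 (vLocPrmD_ok hn hv hW he L0 N) (vLocPrmD_dL hv e W L0 N)).R' : ℕ) : Site 2))
      (((vLocPrmD n ℓ h v e W L0 N).scheduleN 1 0 (vLocPrmD_ok hn hv hW he L0 N) (vLocPrmD_dL hv e W L0 N)).hi k +
        ((((vLocPrmD n ℓ h v e W L0 N).scheduleN 1 0 (vLocPrmD_ok hn hv hW he L0 N) (vLocPrmD_dL hv e W L0 N)).R' : ℕ) : Site 2)))
    (hw : w ∈ pgTopPieceW G φ t n h ℓ R (LocPrm.dir (runX φ c₀ n h 1 t 1))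
      (LocPrm.steerT (LocPrm.dir (runX φ c₀ n h 1 t 1)) (runX φ c₀ n h 1 t 0)) v) :
    runX φ c₀ n h 1 w ∈ ((vLocPrmD n ℓ h v e W L0 N).scheduleN 1 0 (vLocPrmD_ok hn hv hW he L0 N) (vLocPrmD_dL hv e W L0 N)).core (k + 1) := by
  set P := vLocPrmD n ℓ h v e W L0 N with hP
  set σw := LocPrm.dir (runX φ c₀ n h 1 t 1) with hσw
  set τ₀ := LocPrm.steerT σw (runX φ c₀ n h 1 t 0) with hτ₀
  have hσ : σw = 1 ∨ σw = -1 := LocPrm.dir_eq_or _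
  have hc' : 0 < (shearUnit n h : ℤ) := shearUnit_pos hn h
  have ht' := (mem_vLocDSched_enl_iff (vLocPrmD_ok hn hv hW he L0 N) (vLocPrmD_dL hv e W L0 N)).1 ht
  obtain ⟨hb1, hb2, hαn, hp1, hm1⟩ := topPieceW_run_bounds hσ hw
  -- along (axis `1`): the floored `β′` reading, both signs
  have hsLo : P.sLo = ((n : ℤ) * ℓ - (shearUnit n h : ℕ) + 1) / (shearUnit n h : ℕ) - 1 := rfl
  have hsHi : P.sHi = (n : ℤ) * ℓ / (shearUnit n h : ℕ) + 1 := rfl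
  have halong : P.sLo ≤ σw * (runX φ c₀ n h 1 w 1 - runX φ c₀ n h 1 t 1) ∧ σw * (runX φ c₀ n h 1 w 1 - runX φ c₀ n h 1 t 1) ≤ P.sHi := by
    rw [hsLo, hsHi]
    have hU : ((shearUnit n h : ℕ) : ℤ) = ((n + h.natAbs : ℕ) : ℤ) := rfl
    rw [hU]
    rcases hσ with hs | hs <;> rw [hs] at hb1 hb2 ⊢
    · rw [one_mul] at hb1 hb2
      obtain ⟨hl, hu⟩ := runX_sub_runX_one_bounds hn φ c₀ h 1 t w (a := (n : ℤ) * ℓ - (n + h.natAbs : ℕ) + 1) (b := (n : ℤ) * ℓ)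
        (by rw [one_mul]; exact hb1) (by rw [one_mul]; exact hb2)
      rw [hU] at hl hu
      constructor <;> linarith
    · have hb1' : -((n : ℤ) * ℓ) ≤ 1 * shearCoord φ t n h w := by linarith
      have hb2' : 1 * shearCoord φ t n h w ≤ -((n : ℤ) * ℓ - (n + h.natAbs : ℕ) + 1) := by linarith
      obtain ⟨hl, hu⟩ := runX_sub_runX_one_bounds hn φ c₀ h 1 t w hb1' hb2'
      have hnb := neg_ediv_neg_bounds ((n : ℤ) * ℓ) hc'
      have hna := neg_ediv_neg_bounds ((n : ℤ) * ℓ - (n + h.natAbs : ℕ) + 1) hc'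
      rw [hU] at hl hu hnb hna
      constructor <;> linarith
  -- transverse (axis `0`): `σ_w·Δα − v` in the exact piece of sign `τ₀`
  have h0 : runX φ c₀ n h 1 w 0 - runX φ c₀ n h 1 t 0 = relCoord φ t 0 w := by rw [runX_sub_runX_zero, one_mul]
  have hpiece : P.InPiece τ₀ (σw * (runX φ c₀ n h 1 w 0 - runX φ c₀ n h 1 t 0)) := by
    have hPp : (P.Pp : ℤ) = n - v := by
      show (((n - v).toNat : ℕ) : ℤ) = n - v; rw [Int.toNat_of_nonneg (by linarith [(abs_le.1 hv).2])]
    have hPm : (P.Pm : ℤ) = n + v := by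
      show (((n + v).toNat : ℕ) : ℤ) = n + v; rw [Int.toNat_of_nonneg (by linarith [(abs_le.1 hv).1])]
    have hd : P.d = v := rfl
    rw [LocPrmD.InPiece, hPp, hPm, hd, h0]
    have hσα : σw * relCoord φ t 0 w ≤ n := by
      rcases hσ with hs | hs <;> rw [hs] <;> [linarith [(abs_le.1 hαn).2]; linarith [(abs_le.1 hαn).1]]
    have hσα' : -(n : ℤ) ≤ σw * relCoord φ t 0 w := by
      rcases hσ with hs | hs <;> rw [hs] <;> [linarith [(abs_le.1 hαn).1]; linarith [(abs_le.1 hαn).2]]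
    constructor
    · intro h1; have := hp1 h1; constructor <;> linarith
    · intro h1; have := hm1 h1; constructor <;> linarith
  rw [LocPrmD.scheduleN_core, LocPrmD.mem_pcore_iff]
  simp only [Pi.zero_apply, sub_zero, oth_one₁]
  have hcore := LocPrmD.inCore_succ_of_landing (vLocPrmD_ok hn hv hW he L0 N) (a' := runX φ c₀ n h 1 w 1) (b' := runX φ c₀ n h 1 w 0) ht'
    halong.1 halong.2 hpiece
  exact ⟨hcore.1, by have := hcore.2; unfold LocPrmD.Wk at this; exact this⟩

end VRounds

end Skelφ

end Summit.CriticalPhenomena.PercolationContinuityZ3.Theorems.Transplant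

end
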